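import Mathlib
import Literature.Probability.LatticeModels.TwoPointSupNormMonotone
import Literature.Probability.LatticeModels.PointwiseScalingLimitEtaExists
import Literature.Probability.LatticeModels.ImprovedTreeDiagramBoundProofs
import Summits.CriticalPhenomena.Ising3DConformalLimit.Theorems.OctantEntropyBoxSumToEtaTauberian
import Summits.CriticalPhenomena.Ising3DConformalLimit.Theorems.ThresholdDilationEtaOfDyadicLaw
import Summits.CriticalPhenomena.Ising3DConformalLimit.Theses.OctantEntropy

/-!
# `BoxSumToEta` (route OctantEntropy, item stmt-CriticalPhenomena-5737): the Tauberian transfer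

If the dyadic-window sums `S_K = ∑_{u ∈ [-2^K,2^K)³} ⟨σ₀σ_u⟩⁺_{β_c(3)}` of the critical two-point
function of the nearest-neighbour Ising model on `ℤ³` satisfy `log₂ S_K / K → s`, then the anomalous
dimension exists: `HasIsingExponentEta 3 (2 - s)`, i.e. `log ⟨σ₀σ_x⟩_{β_c} / log ‖x‖ → -(3 - s)`
(`boxSumToEta_proof`).

Proof (Messager–Miracle-Solé in the sup norm, `‖y‖_∞ ≥ 3‖x‖_∞ ⇒ G(y) ≤ G(x)`, plus the Simon–Lieb
lower bound `G(x) ≥ c‖x‖⁻²`):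
* with `g(k) = G(2^k e₁)`, the averaged upper bound `g(k+2) 2^{3(k+1)} ≤ S_{k+1}`
  (`axis_mul_pow_le_windowSum`, from `card_box_mul_twoPointPlus_le_sum_box`) and the shell lower
  bound `S_J ≤ S_{k+2} + 2^{3(J+2)} g(k)` (`windowSum_le_windowSum_add`, from
  `twoPointPlus_le_of_mul_supNorm_le`), and `s ≥ 1` (`windowSum_growth`, from
  `criticalTwoPoint_bounds_holds`) feed the real-analysis core `tendsto_log_div_of_windowSum`
  (helper file `OctantEntropyBoxSumToEtaTauberian`): `log g(k) / k → (s-3) log 2`;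
* the axis sequence `m ↦ G(m e₁)` is antitone, so its exponent `3 - s` extends from dyadic `m` to
  all `m` (`HasDecayExponent.of_dyadic_of_antitone`), and the MMS sphere sandwich gives all
  directions (tree theorem `ThresholdDilationEta.hasIsingExponentEta_of_hasDecayExponent_axis` of
  route ThresholdDilation's `EtaOfDyadicLaw` file, reused).
-/

noncomputable section

open Filter Topology Finset
open Literature.Probability.LatticeModels

namespace Summit.CriticalPhenomena.Ising3DConformalLimit.Theorems

/-! ### Lattice input: dyadic windows and the Messager–Miracle-Solé comparison -/

set_option quotPrecheck false in
/-- The dyadic window `W_K = [-2^K, 2^K)³ ∩ ℤ³` of the route file (the box `Λ_{2^K}` cut by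
`u_i < 2^K`). -/
local notation "𝕎[" K "]" =>
  (Finset.filter (fun u : Site 3 => ∀ i, u i < (2 : ℤ) ^ K) (box 3 (2 ^ K)))

set_option quotPrecheck false in
/-- The window sum `S_K = ∑_{u ∈ W_K} ⟨σ₀σ_u⟩⁺_{β_c(3)}` of the route file. -/
local notation "𝕊[" K "]" => (∑ u ∈ 𝕎[K], criticalTwoPoint 3 u)

/-- Outside the window `W_K` the sup norm is at least `2^K`. [folklore] -/
theorem two_pow_le_supNorm_of_not_mem_window {K : ℕ} {u : Site 3} (hu : u ∉ 𝕎[K]) :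
    2 ^ K ≤ Site.supNorm u := by
  rw [Finset.mem_filter, not_and_or] at hu
  rcases hu with h | h
  · rw [mem_box_iff_supNorm_le, not_le] at h
    exact h.le
  · push Not at h
    obtain ⟨i, hi⟩ := h
    have h1 := Site.natAbs_le_supNorm u i
    have h2 : (2 : ℤ) ^ K ≤ ((u i).natAbs : ℤ) := hi.trans Int.le_natAbs
    have h3 : 2 ^ K ≤ (u i).natAbs := by exact_mod_cast h2
    exact h3.trans h1

/-- The box `Λ_{2^K}` lies inside the next window `W_{K+1}`. [folklore] -/
theorem box_subset_window_succ (K : ℕ) : box 3 (2 ^ K) ⊆ 𝕎[K + 1] := by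
  intro u hu
  rw [Finset.mem_filter]
  refine ⟨box_mono 3 (Nat.pow_le_pow_right two_pos (Nat.le_succ K)) hu, fun i => ?_⟩
  have h := (mem_box.1 hu i).2
  push_cast at h
  calc u i ≤ 2 ^ K := h
    _ < 2 ^ (K + 1) := pow_lt_pow_right₀ (by norm_num) (Nat.lt_succ_self K)

/-- `W_K ⊆ Λ_{2^K}`. [folklore] -/
theorem window_subset_box (K : ℕ) : 𝕎[K] ⊆ box 3 (2 ^ K) := Finset.filter_subset _ _

/-- `S_K > 0` (it contains the term `⟨σ₀σ₀⟩ = 1`, all terms being `≥ 0` by Griffiths). [folklore] -/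
theorem windowSum_pos (K : ℕ) : 0 < 𝕊[K] := by
  have h0 : (0 : Site 3) ∈ 𝕎[K] := by
    rw [Finset.mem_filter]
    exact ⟨zero_mem_box 3 _, fun i => by simp⟩
  have h1 : criticalTwoPoint 3 0 ≤ 𝕊[K] :=
    Finset.single_le_sum (fun u _ => criticalTwoPoint_nonneg' u) h0
  rw [criticalTwoPoint_zero'] at h1
  linarith

/-- **MMS upper bound, averaged** (Aizenman–Duminil-Copin 2021, §5.3): since `3 · 2^k ≤ 2^{k+2}`,
`|Λ_{2^k}| ⟨σ₀σ_{2^{k+2} e₁}⟩ ≤ ∑_{y ∈ Λ_{2^k}} ⟨σ₀σ_y⟩ ≤ S_{k+1}`, and `|Λ_{2^k}| ≥ 2^{3(k+1)}`.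
[cite: AizenmanDuminilCopinAnnals2021, arXiv:1912.07973 §5.3, display after the proof of Thm 5.6 (p. 19), first inequality] -/
theorem axis_mul_pow_le_windowSum (k : ℕ) :
    criticalTwoPoint 3 (Pi.single 0 ((2 ^ (k + 2) : ℕ) : ℤ)) * 2 ^ (3 * (k + 1)) ≤ 𝕊[k + 1] := by
  have hβ := criticalBeta_nonneg 3
  have h3 : 3 * 2 ^ k ≤ Site.supNorm (Pi.single (0 : Fin 3) ((2 ^ (k + 2) : ℕ) : ℤ) : Site 3) := by
    rw [Site.supNorm_single, Int.natAbs_natCast, pow_add]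
    omega
  have hmms := card_box_mul_twoPointPlus_le_sum_box (d := 3) hβ h3
  have hcard : (2:ℝ) ^ (3 * (k + 1)) ≤ (#(box 3 (2 ^ k)) : ℝ) := by
    rw [card_box]
    push_cast
    have e : (2:ℝ) ^ (3 * (k + 1)) = (2 * 2 ^ k) ^ 3 := by ring
    rw [e]
    gcongr
    linarith
  have hsub : ∑ y ∈ box 3 (2 ^ k), twoPointPlus 3 (criticalBeta 3) y ≤ 𝕊[k + 1] :=
    Finset.sum_le_sum_of_subset_of_nonneg (box_subset_window_succ k)
      fun u _ _ => criticalTwoPoint_nonneg' u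
  have hG : 0 ≤ criticalTwoPoint 3 (Pi.single 0 ((2 ^ (k + 2) : ℕ) : ℤ)) :=
    criticalTwoPoint_nonneg' _
  calc criticalTwoPoint 3 (Pi.single 0 ((2 ^ (k + 2) : ℕ) : ℤ)) * 2 ^ (3 * (k + 1))
      ≤ criticalTwoPoint 3 (Pi.single 0 ((2 ^ (k + 2) : ℕ) : ℤ)) * #(box 3 (2 ^ k)) :=
        mul_le_mul_of_nonneg_left hcard hG
    _ = #(box 3 (2 ^ k)) * twoPointPlus 3 (criticalBeta 3) (Pi.single 0 ((2 ^ (k + 2) : ℕ) : ℤ)) :=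
        mul_comm _ _
    _ ≤ ∑ y ∈ box 3 (2 ^ k), twoPointPlus 3 (criticalBeta 3) y := hmms
    _ ≤ 𝕊[k + 1] := hsub

/-- **MMS lower bound, shell form** (Aizenman–Duminil-Copin 2021, eq. (5.3)): a site outside
`W_{k+2}` has `‖u‖_∞ ≥ 2^{k+2} ≥ 3 · 2^k`, so `⟨σ₀σ_u⟩ ≤ ⟨σ₀σ_{2^k e₁}⟩`; splitting `S_J` along
`W_{k+2}` gives `S_J ≤ S_{k+2} + |Λ_{2^J}| ⟨σ₀σ_{2^k e₁}⟩ ≤ S_{k+2} + 2^{3(J+2)} ⟨σ₀σ_{2^k e₁}⟩`.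
[cite: AizenmanDuminilCopinAnnals2021, arXiv:1912.07973 §5.1, eq. (5.3) (display after Prop. 5.1)] -/
theorem windowSum_le_windowSum_add (k J : ℕ) :
    𝕊[J] ≤ 𝕊[k + 2] + 2 ^ (3 * (J + 2)) * criticalTwoPoint 3 (Pi.single 0 ((2 ^ k : ℕ) : ℤ)) := by
  have hβ := criticalBeta_nonneg 3
  rw [← Finset.sum_filter_add_sum_filter_not (𝕎[J]) (fun u => u ∈ 𝕎[k + 2])]
  refine add_le_add ?_ ?_
  · exact Finset.sum_le_sum_of_subset_of_nonneg (fun u hu => (Finset.mem_filter.1 hu).2)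
      fun u _ _ => criticalTwoPoint_nonneg' u
  · have h1 : ∑ u ∈ (𝕎[J]).filter (fun u => u ∉ 𝕎[k + 2]), criticalTwoPoint 3 u ≤
        #((𝕎[J]).filter (fun u => u ∉ 𝕎[k + 2])) •
          criticalTwoPoint 3 (Pi.single 0 ((2 ^ k : ℕ) : ℤ)) := by
      refine Finset.sum_le_card_nsmul _ _ _ fun u hu => ?_
      have hu' := (Finset.mem_filter.1 hu).2
      have hsup := two_pow_le_supNorm_of_not_mem_window hu'
      refine twoPointPlus_le_of_mul_supNorm_le hβ ?_
      rw [Site.supNorm_single, Int.natAbs_natCast]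
      calc 3 * 2 ^ k ≤ 2 ^ (k + 2) := by rw [pow_add]; omega
        _ ≤ Site.supNorm u := hsup
    have h2 : (#((𝕎[J]).filter (fun u => u ∉ 𝕎[k + 2])) : ℝ) ≤ 2 ^ (3 * (J + 2)) := by
      have hc : #((𝕎[J]).filter (fun u => u ∉ 𝕎[k + 2])) ≤ #(box 3 (2 ^ J)) :=
        Finset.card_le_card ((Finset.filter_subset _ _).trans (window_subset_box J))
      rw [card_box] at hc
      have hc' : (#((𝕎[J]).filter (fun u => u ∉ 𝕎[k + 2])) : ℝ) ≤ (2 * 2 ^ J + 1) ^ 3 := by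
        exact_mod_cast hc
      refine hc'.trans ?_
      have e : (2:ℝ) ^ (3 * (J + 2)) = (4 * 2 ^ J) ^ 3 := by ring
      rw [e]
      gcongr
      have : (1:ℝ) ≤ 2 ^ J := one_le_pow₀ (by norm_num)
      linarith
    rw [nsmul_eq_mul] at h1
    exact h1.trans (mul_le_mul_of_nonneg_right h2 (criticalTwoPoint_nonneg' _))

/-- **Growth of the window sums** (Simon–Lieb lower bound read on the axis): there is `c > 0` with
`c 2^k ≤ S_{k+1}`, since `⟨σ₀σ_{2^{k+2} e₁}⟩ ≥ c' 2^{-2(k+2)}` (`criticalTwoPoint_bounds_holds`) and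
`⟨σ₀σ_{2^{k+2} e₁}⟩ 2^{3(k+1)} ≤ S_{k+1}`. [cite: Simon1980, Theorem 1] -/
theorem windowSum_growth : ∃ c : ℝ, 0 < c ∧ ∀ k : ℕ, c * 2 ^ k ≤ 𝕊[k + 1] := by
  obtain ⟨c, C, hc, hbd⟩ := criticalTwoPoint_bounds_holds (d := 3) le_rfl
  refine ⟨c / 2, by positivity, fun k => ?_⟩
  have hv0 : (Pi.single 0 ((2 ^ (k + 2) : ℕ) : ℤ) : Site 3) ≠ 0 := by
    intro h
    have h' := congr_fun h 0
    simp at h'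
  have hlow := (hbd _ hv0).1
  have hnorm : ‖(Pi.single 0 ((2 ^ (k + 2) : ℕ) : ℤ) : Site 3)‖ = (2:ℝ) ^ (k + 2) := by
    rw [Site.norm_eq_supNorm, Site.supNorm_single, Int.natAbs_natCast]
    push_cast
    ring
  have e3 : (-(((3:ℕ):ℝ) - 1)) = -(2 : ℝ) := by norm_num
  rw [hnorm, e3, Real.rpow_neg (by positivity), Real.rpow_two] at hlow
  have hU := axis_mul_pow_le_windowSum k
  calc c / 2 * 2 ^ k = c * (((2:ℝ) ^ (k + 2)) ^ 2)⁻¹ * 2 ^ (3 * (k + 1)) := by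
        field_simp
        ring
    _ ≤ criticalTwoPoint 3 (Pi.single 0 ((2 ^ (k + 2) : ℕ) : ℤ)) * 2 ^ (3 * (k + 1)) :=
        mul_le_mul_of_nonneg_right hlow (by positivity)
    _ ≤ 𝕊[k + 1] := hU

/-! ### The item -/

/-- **`BoxSumToEta` (route OctantEntropy, support item stmt-CriticalPhenomena-5737).** If
`log₂ S_K / K → s` for the dyadic-window sums `S_K = ∑_{u ∈ [-2^K,2^K)³} ⟨σ₀σ_u⟩⁺_{β_c(3)}`, then
`η := 2 - s` is the anomalous dimension of the critical Ising model on `ℤ³`: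
`HasIsingExponentEta 3 (2 - s)`. Messager–Miracle-Solé in the sup norm plus the Simon–Lieb lower
bound (which gives `s ≥ 1 > 0`). [cite: MessagerMiracleSoleJSP1977, main theorem (monotonicity of ⟨σ₀σ_x⟩ under reflections)] -/
theorem boxSumToEta_proof :
    Summit.CriticalPhenomena.Ising3DConformalLimit.Theses.OctantEntropy.BoxSumToEta := by
  rintro ⟨s, hs⟩
  have hℓpos : 0 < Real.log 2 := Real.log_pos one_lt_two
  -- natural logarithms
  have hb : Tendsto (fun K : ℕ => Real.log (𝕊[K]) / K) atTop (𝓝 (s * Real.log 2)) := by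
    have h := hs.mul_const (Real.log 2)
    refine h.congr fun K => ?_
    rw [Real.logb]
    field_simp
  -- `s ≥ 1` from the growth of the window sums
  obtain ⟨c, hc, hgrowth⟩ := windowSum_growth
  have hs1 : 1 ≤ s := by
    have hb1 : Tendsto (fun k : ℕ => Real.log (𝕊[k + 1]) / ((k + 1 : ℕ) : ℝ)) atTop
        (𝓝 (s * Real.log 2)) := hb.comp (tendsto_add_atTop_nat 1)
    have hlow : Tendsto (fun k : ℕ => Real.log c / ((k : ℝ) + 1) +
        Real.log 2 * ((k : ℝ) / ((k : ℝ) + 1))) atTop (𝓝 (0 + Real.log 2 * 1)) :=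
      (((tendsto_const_div_atTop_nhds_zero_nat (Real.log c)).comp
        (tendsto_add_atTop_nat 1)).congr (fun k => by simp)).add
        ((tendsto_natCast_div_add_atTop (1:ℝ)).const_mul (Real.log 2))
    rw [zero_add, mul_one] at hlow
    have hle := le_of_tendsto_of_tendsto' hlow hb1 fun k => by
      have hk : (0:ℝ) < (k : ℝ) + 1 := by positivity
      have h1 : Real.log c + k * Real.log 2 ≤ Real.log (𝕊[k + 1]) := by
        rw [← Real.log_pow, ← Real.log_mul hc.ne' (by positivity)]
        exact Real.log_le_log (by positivity) (hgrowth k)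
      have e : Real.log c / ((k : ℝ) + 1) + Real.log 2 * ((k : ℝ) / ((k : ℝ) + 1)) =
          (Real.log c + k * Real.log 2) / ((k : ℝ) + 1) := by
        field_simp
      rw [e]
      push_cast
      exact div_le_div_of_nonneg_right h1 hk.le
    nlinarith
  -- the core step on the dyadic axis points
  have hcore := tendsto_log_div_of_windowSum (S := fun K => 𝕊[K])
    (g := fun k => criticalTwoPoint 3 (Pi.single 0 ((2 ^ k : ℕ) : ℤ))) windowSum_pos
    (fun k => criticalTwoPoint_axis_pos _) (by linarith) hb axis_mul_pow_le_windowSum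
    windowSum_le_windowSum_add
  -- fill in between dyadic scales along the (antitone) axis
  have hax : HasDecayExponent (fun m : ℕ => criticalTwoPoint 3 (Pi.single 0 (m : ℤ))) (3 - s) := by
    refine HasDecayExponent.of_dyadic_of_antitone criticalTwoPoint_axis_pos
      criticalTwoPoint_axis_antitone ?_
    convert hcore using 2
    ring
  -- all directions
  have hη := ThresholdDilationEta.hasIsingExponentEta_of_hasDecayExponent_axis hax
  refine ⟨2 - s, ?_⟩
  have e : (2:ℝ) - s = 3 - s - 1 := by ring
  rw [e]
  exact hη


end Summit.CriticalPhenomena.Ising3DConformalLimit.Theorems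

end
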